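import Summits.ResolutionOfSingularities.ResolutionOfSingularities.Theorems.MarkedTransferCampaignW46CuspStaircaseSharp
import HarnessLib

/-!
# [OURS · L1 W4.6, rung (iii)] The cusp staircase, XIV — the STEP COUNT `ℓ(E) = Σ_ξ ⌊index(ξ)/b⌋`: one invariant for the
# window bound `#Sing(E₀)` and the staircase bound, dropping by at least one at EVERY permissible blow-up
# (cell res-hironaka, LADDER-RESOLUTION rung L, D-0089; slot W4.6, seat res-L1-s46-pv-5 gen 3; host route MarkedTransfer,
# `--kind proof --supports stmt-ResolutionOfSingularities-16155 --as helper`)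

HONEST FRAMING. Everything below is OURS: kernel theorems about the campaign objects of this seat's files I–XIII
(`CampaignW46.cuspMultiset`, `cuspIndexAt`, `Regime.cuspCurve`, `Regime.mohWindowCurve`) and pv-1's résumé-free
`FinPermissibleRun`. NOTHING here is a statement of H. Hironaka's manuscript *Resolution of singularities in positive
characteristics* (2017-03-23, [Hironaka2017]) and nothing here asserts that any statement of it holds. No FACT-LIST
premise is used. AI review is weaker than expert review. No `sorry`; axioms standard; def-free (the step count is written
as `((cuspMultiset E).map (· / E.b)).sum`).

## What is proved

* `Cusp.transform_stepCount_add_one_le` — for a staircase state and ANY §2.1-permissible point blow-up: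
  `ℓ(E′) + 1 ≤ ℓ(E)` where `ℓ(E) := Σ_{ξ ∈ Sing(E)} ⌊index(ξ)/b⌋` (off the centre the indices are unchanged; over the centre
  there is at most one singular point and its index is `≤ index(ξ) − b`, files X/VI).
* `FinPermissibleRun.stepCount_add_le`, **`FinPermissibleRun.len_le_stepCount`** — every finite §2.1-permissible sequence from
  a staircase state `(A₀, E₀)` has length `≤ ℓ(E₀)`. This SHARPENS file XI's `len ≤ Σ(E₀)/b` (as `Σ⌊dᵢ/b⌋ ≤ ⌊Σdᵢ/b⌋`) and
  CONTAINS the window bound: in the window every index lies in `(b, 2b)`, so `ℓ(E₀) = #Sing(E₀)`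
  (`stepCount_eq_ncard_of_mohWindowCurve`). For K4.6's `E_n` it is `⌊index/p⌋ ≤ ⌊n/p⌋`, attained (file XIII).

## References

* This seat, files VI (`…CuspStaircaseDichotomy`), X–XIII; seat pv-1 `…FiniteExitBound.lean`.
* H. Hironaka, ms. 2017-03-23, §2.1 p.4 l.35–39, Th. 16.13 p.87 l.26–28 — scope only, under adjudication, not cited as
  fact. [Hironaka2017]
-/

noncomputable section

set_option linter.dupNamespace false -- mandated namespace of this single-conjunct summit

open CategoryTheory AlgebraicGeometry TopologicalSpace IsLocalRing

namespace Summit.ResolutionOfSingularities.ResolutionOfSingularities.Theorems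

namespace CampaignW46

open Literature.AlgebraicGeometry.Resolution
open Literature.AlgebraicGeometry.Hironaka2017.S02Preliminaries
open Literature.AlgebraicGeometry.Hironaka2017.Datum
open Scheme.IdealSheafData

universe u

variable {p : ℕ} [Fact p.Prime] {K : Type u} [Field K] [CharP K p]

/-- Unfolding the step count `ℓ(E) = ((cuspMultiset E).map (· / b)).sum` as a finite sum over `Sing(E)`. [folklore] -/
theorem stepCount_eq_sum {Z : Scheme.{u}} (F : IdealExponent Z) (h : F.sing.Finite) (b : ℕ) :
    ((cuspMultiset F).map (· / b)).sum = ∑ z ∈ h.toFinset, cuspIndexAt F z / b := by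
  rw [cuspMultiset_eq _ h, Multiset.map_map, Finset.sum_eq_multiset_sum]
  rfl

namespace Cusp

variable {A A' : AmbientDatum p K} {E : IdealExponent A.Z} {D : Closeds A.Z} {π : A'.Z ⟶ A.Z}

/-- [OURS · L1 W4.6 rung (iii); NOT a statement of the manuscript] **The step count drops by at least one at every
permissible blow-up**, résumé-free: for a staircase state `(A, E)`, an irreducible closed `D ⊆ Sing(E)` and the blow-up
`π` along its reduced ideal, `ℓ(E′) + 1 ≤ ℓ(E)` with `ℓ(E) = Σ_{ξ ∈ Sing(E)} ⌊index(ξ)/b⌋` — off the centre the indices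
agree (`transform_mem_sing_and_cuspIndexAt_eq_of_ne`, injectivity), over the centre there is at most one singular point
(`transform_sing_over_subsingleton`) with `index + b ≤ index(ξ)` (`transform_cuspAt_and_cuspIndexAt_le_of_over`), and
`index(ξ) > b`. [folklore] -/
theorem transform_stepCount_add_one_le (hπ : IsBlowup π (vanishingIdeal D)) (hRg : Regime.cuspCurve A E)
    (hDirr : IsIrreducible (D : Set A.Z)) (hDS : (D : Set A.Z) ⊆ E.sing) :
    ((cuspMultiset (E.transform π D)).map (· / E.b)).sum + 1 ≤ ((cuspMultiset E).map (· / E.b)).sum := by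
  classical
  obtain ⟨ξ, hξS, hξcl, hDξ⟩ := exists_eq_singleton_of_subset_sing hRg.2.2.1 hDirr hDS
  have hb : 0 < E.b := hRg.1
  have hfin : E.sing.Finite := hRg.2.1
  have hfin' : (E.transform π D).sing.Finite := (transform_sing_finite_and_ncard_le hπ hRg hDirr hDS).1
  obtain ⟨S, hS⟩ : ∃ S : Finset A.Z, S = hfin.toFinset := ⟨_, rfl⟩
  obtain ⟨S', hS'⟩ : ∃ S' : Finset A'.Z, S' = hfin'.toFinset := ⟨_, rfl⟩
  have hmemS : ∀ z, z ∈ S ↔ z ∈ E.sing := fun z => by rw [hS, Set.Finite.mem_toFinset]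
  have hmemS' : ∀ z, z ∈ S' ↔ z ∈ (E.transform π D).sing := fun z => by rw [hS', Set.Finite.mem_toFinset]
  set Soff := S'.filter (fun x' => π.base x' ≠ ξ) with hSoff
  set Sfib := S'.filter (fun x' => ¬ π.base x' ≠ ξ) with hSfib
  set T := Soff.image π.base with hT
  set f : A.Z → ℕ := fun z => cuspIndexAt E z / E.b with hf
  set f' : A'.Z → ℕ := fun z => cuspIndexAt (E.transform π D) z / E.b with hf'
  have hoff : ∀ x' ∈ Soff, π.base x' ∈ E.sing ∧
      cuspIndexAt (E.transform π D) x' = cuspIndexAt E (π.base x') :=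
    fun x' hx' => transform_mem_sing_and_cuspIndexAt_eq_of_ne hπ hDξ ((hmemS' x').mp (Finset.mem_filter.mp hx').1)
      (Finset.mem_filter.mp hx').2
  have hinj : ∀ x₁ ∈ Soff, ∀ x₂ ∈ Soff, π.base x₁ = π.base x₂ → x₁ = x₂ := by
    intro x₁ hx₁ x₂ hx₂ h
    refine MohWindow.injOn_preimage_compl hπ ?_ ?_ h
    · show π.base x₁ ∈ (D : Set A.Z)ᶜ
      rw [hDξ]; exact (Finset.mem_filter.mp hx₁).2
    · show π.base x₂ ∈ (D : Set A.Z)ᶜ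
      rw [hDξ]; exact (Finset.mem_filter.mp hx₂).2
  have hTS : T ⊆ S.erase ξ := by
    intro z hz
    obtain ⟨x', hx', rfl⟩ := Finset.mem_image.mp hz
    exact Finset.mem_erase.mpr ⟨(Finset.mem_filter.mp hx').2, (hmemS _).mpr (hoff x' hx').1⟩
  have hξmem : ξ ∈ S := (hmemS ξ).mpr hξS
  obtain ⟨hnd, hshape⟩ := Cusp.cuspIndex_spec (hRg.2.2.2 ξ hξS)
  have hbd : E.b < cuspIndexAt E ξ := Cusp.lt_of_cuspShape_of_le_pow hshape hnd (stalkIdeal_le_pow_of_mem_sing hξS)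
  have hM' : ((cuspMultiset (E.transform π D)).map (· / E.b)).sum = ∑ x' ∈ Soff, f' x' + ∑ x' ∈ Sfib, f' x' := by
    rw [stepCount_eq_sum _ hfin', ← hS', hSoff, hSfib, Finset.sum_filter_add_sum_filter_not]
  have hM : ((cuspMultiset E).map (· / E.b)).sum = ∑ z ∈ S.erase ξ, f z + f ξ := by
    rw [stepCount_eq_sum _ hfin, ← hS, Finset.sum_erase_add S _ hξmem]
  have hX : ∑ x' ∈ Soff, f' x' = ∑ z ∈ T, f z := by
    rw [hT, Finset.sum_image hinj]
    refine Finset.sum_congr rfl fun x' hx' => ?_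
    simp only [hf, hf', (hoff x' hx').2]
  have hXle : ∑ z ∈ T, f z ≤ ∑ z ∈ S.erase ξ, f z := Finset.sum_le_sum_of_subset hTS
  have hfib : ∑ x' ∈ Sfib, f' x' + 1 ≤ f ξ := by
    rcases Sfib.eq_empty_or_nonempty with h0 | ⟨x₀, hx₀⟩
    · rw [h0, Finset.sum_empty, zero_add]
      show 1 ≤ cuspIndexAt E ξ / E.b
      exact (Nat.le_div_iff_mul_le hb).mpr (by omega)
    · have hsub : ∀ x' ∈ Sfib, x' = x₀ := fun x' hx' => by
        have hx'm := Finset.mem_filter.mp hx'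
        have hx₀m := Finset.mem_filter.mp hx₀
        exact transform_sing_over_subsingleton hπ hRg hξS hDξ ⟨(hmemS' _).mp hx'm.1, not_not.mp hx'm.2⟩
          ⟨(hmemS' _).mp hx₀m.1, not_not.mp hx₀m.2⟩
      have hSfib1 : Sfib = {x₀} := Finset.eq_singleton_iff_unique_mem.mpr ⟨hx₀, hsub⟩
      rw [hSfib1, Finset.sum_singleton]
      have hx₀m := Finset.mem_filter.mp hx₀
      have hle := (transform_cuspAt_and_cuspIndexAt_le_of_over hπ hRg hξS hDξ ((hmemS' _).mp hx₀m.1)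
        (not_not.mp hx₀m.2)).2
      show cuspIndexAt (E.transform π D) x₀ / E.b + 1 ≤ cuspIndexAt E ξ / E.b
      rw [← Nat.add_div_right _ hb]
      exact Nat.div_le_div_right hle
  rw [hM', hM, hX]
  omega

end Cusp

/-! ## The step count along finite permissible sequences -/

namespace FinPermissibleRun

variable (r : FinPermissibleRun p K)

/-- [OURS · L1 W4.6 rung (iii); NOT a statement of the manuscript] Along a finite §2.1-permissible sequence from a staircase
state, `ℓ(E_k) + k ≤ ℓ(E₀)` for every `k ≤ len` (`Cusp.transform_stepCount_add_one_le` at every step). [folklore] -/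
theorem stepCount_add_le (h0 : Regime.cuspCurve (p := p) (K := K) (r.A 0) (r.E 0)) :
    ∀ k, k ≤ r.len →
      ((cuspMultiset (r.E k)).map (· / (r.E 0).b)).sum + k ≤ ((cuspMultiset (r.E 0)).map (· / (r.E 0).b)).sum
  | 0, _ => by simp
  | k + 1, hk => by
    have hk' : k < r.len := hk
    have hstep := Cusp.transform_stepCount_add_one_le (r.blowup k hk') (r.cuspCurve_of_zero h0 k hk'.le)
      (r.permissible k hk').irreducible (r.permissible k hk').subset_sing
    rw [← r.E_succ k hk', r.b_eq_of_le k hk'.le] at hstep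
    have ih := stepCount_add_le h0 k hk'.le
    omega

/-- [OURS · L1 W4.6 rung (iii); NOT a statement of the manuscript] **THE STEP-COUNT BOUND**: every finite §2.1-permissible
blow-up sequence whose stage `0` is a staircase state `(A₀, E₀)` has length at most
`ℓ(E₀) = Σ_{ξ ∈ Sing(E₀)} ⌊index(ξ)/b⌋`. Sharpens `len_le_sum_div_of_cuspCurve` (file XI) and specialises to
`len_le_ncard_of_mohWindowCurve` in the window (`stepCount_eq_ncard_of_mohWindowCurve`). [folklore] -/
theorem len_le_stepCount (h0 : Regime.cuspCurve (p := p) (K := K) (r.A 0) (r.E 0)) :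
    r.len ≤ ((cuspMultiset (r.E 0)).map (· / (r.E 0).b)).sum := by
  have h := r.stepCount_add_le h0 r.len le_rfl
  omega

end FinPermissibleRun

/-- [OURS · L1 W4.6 rung (iii); NOT a statement of the manuscript] **In the window the step count is the number of singular
points**: for a window state every index lies in `(b, 2b)` (`Cusp.cuspIndex_lt_two_mul_of_mohWindowAt`, file VI; `> b` at a
singular point), so `⌊index(ξ)/b⌋ = 1` for each `ξ ∈ Sing(E)` and `ℓ(E) = #Sing(E)`. [folklore] -/
theorem stepCount_eq_ncard_of_mohWindowCurve {A : AmbientDatum p K} {E : IdealExponent A.Z}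
    (hRg : Regime.mohWindowCurve (p := p) (K := K) A E) :
    ((cuspMultiset E).map (· / E.b)).sum = E.sing.ncard := by
  classical
  obtain ⟨hfin, -, hwin⟩ := hRg
  rw [stepCount_eq_sum _ hfin, Set.ncard_eq_toFinset_card _ hfin, Finset.card_eq_sum_ones]
  refine Finset.sum_congr rfl fun ξ hξ => ?_
  have hξS : ξ ∈ E.sing := (Set.Finite.mem_toFinset hfin).mp hξ
  have hW := hwin ξ hξS
  have hb : 0 < E.b := MohWindow.pos_of_mohWindowAt hW
  have hlt : cuspIndexAt E ξ < 2 * E.b := Cusp.cuspIndex_lt_two_mul_of_mohWindowAt hW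
  obtain ⟨hnd, hshape⟩ := Cusp.cuspIndex_spec (MohWindowAt.cuspAt hW)
  have hgt : E.b < cuspIndexAt E ξ :=
    Cusp.lt_of_cuspShape_of_le_pow hshape hnd (stalkIdeal_le_pow_of_mem_sing hξS)
  show cuspIndexAt E ξ / E.b = 1
  apply le_antisymm
  · exact Nat.lt_succ_iff.mp ((Nat.div_lt_iff_lt_mul hb).mpr (by omega))
  · exact (Nat.le_div_iff_mul_le hb).mpr (by omega)

end CampaignW46

end Summit.ResolutionOfSingularities.ResolutionOfSingularities.Theorems

end
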